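import Summits.BirchSwinnertonDyer.BirchSwinnertonDyer.Theses.KolyvaginRankRigidityAtTwo
import Summits.BirchSwinnertonDyer.BirchSwinnertonDyer.Theorems.KolyvaginRankRigidityAtTwoSwapInduction
import Summits.BirchSwinnertonDyer.BirchSwinnertonDyer.Theorems.KolyvaginRankRigidityAtTwoNoTwoTorsionOverK
import Summits.BirchSwinnertonDyer.BirchSwinnertonDyer.Theorems.KolyvaginRankRigidityAtTwoLevelTriangularSystem
import Summits.BirchSwinnertonDyer.BirchSwinnertonDyer.Theorems.KolyvaginRankRigidityAtTwoKolyvaginCorankLowerBoundAtTwoConjSign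
import Summits.BirchSwinnertonDyer.BirchSwinnertonDyer.Theorems.KolyvaginRankRigidityAtTwoKolyvaginCorankLowerBoundAtTwoLocalTrivialAtConductor
import Summits.BirchSwinnertonDyer.BirchSwinnertonDyer.Theorems.KolyvaginRankRigidityAtTwoKolyvaginCorankLowerBoundAtTwoSelmerAwayFromConductor
import Summits.BirchSwinnertonDyer.BirchSwinnertonDyer.Theorems.KolyvaginRankRigidityAtTwoKolyvaginCorankLowerBoundAtTwoMarginChebotarevOneClassIndexAtTwo
import Summits.BirchSwinnertonDyer.BirchSwinnertonDyer.Theorems.KolyvaginRankRigidityAtTwoKolyvaginCorankLowerBoundAtTwoMarginLocalOrderLevelUpAtTwo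
import Summits.BirchSwinnertonDyer.BirchSwinnertonDyer.Theorems.KolyvaginRankRigidityAtTwoKolyvaginCorankLowerBoundAtTwoThetaGlobalOrderLevelUp
import Literature.NumberTheory.EllipticCurves.ArtinFormalismQuadraticLocalProofs
import Literature.NumberTheory.EllipticCurves.HeegnerPointsOfConductorOneGaloisConjProofs
import Literature.NumberTheory.EllipticCurves.BSDSelmerPConverseYanZhuKolyvaginSystemProofs
import Literature.NumberTheory.EllipticCurves.LeadingTermProofs
import Literature.NumberTheory.EllipticCurves.SelmerCorankHolds
import Literature.NumberTheory.EllipticCurves.MordellWeilTheoremProofs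
import HarnessLib

/-!
# LINE skeleton for crux V2♭θ `KolyvaginCorankLowerBoundAtTwoTheta` (stmt-BirchSwinnertonDyer-27220;
# R4-θ successor of V2♭ₘ 27015 / V2♭ 24623), route `KolyvaginRankRigidityAtTwo` — line
# `kolyvagin_depth_split` (lead krr2-p1 g7 RESHAPE 3: the whole Kolyvagin induction reduced to the PRIME SWAP)

V2♭θ: on the surjective-2-adic Heegner habitat there are `θ, k` such that every non-zero Kolyvagin
class `c_M(n) ≠ 0` with `θ·M + k ≤ M(n)` whose depth `ν = #(ℓ ∣ n)` is minimal among such classes has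
`ν + 1 ≤ c ∨ ν + 1 ≤ c'` (`c, c'` = `ℤ₂`-coranks of `Sel_(2^∞)` of `E`, `E^(d_K)`). We prove it with
`θ = 2` (Kolyvagin's `2 m(λ₀) < n(λ₀)`, Math. Ann. 291 p. 257) and `k = c₀ + 2c₁ + 1`.

Structure (all compositions PROVED in this file; `sorry` only in the registered stubs):
* depth `0`: `depthZeroMargin` (Mordell–Weil road; copy of the landed `stub_depthZero` p606050
  without the idle minimality binder) — PROVED;
* depth `ν ≥ 1`: `posDepthTheta` — PROVED from the stubs through the landed
  `windowsTheta_of_swap` (p619681, `Theorems/…SwapInduction`: Kolyvagin's windows at every level from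
  ONE step) and `lowerBound_of_levelTriangularSystems` (p610758), with T2 (p612348) and T3 (p611883):
  - `stub_primeSwapAtTwo` (S1) — [1, Prop. 8] at `2`, lossless form: THE research kernel;
  - `stub_chebotarevOneClassIndexAtTwo` (S2) — one-class Čebotarev at `2` with index raising (the
    two-level sequel of the landed `exists_kolyvaginPrime_gt_two_eigenclass`, krr2-p2);
  - `stub_localOrderLevelUpAtTwo` (S3), `stub_globalOrderLevelUpAtTwo` (S4) — level bookkeeping
    (tree-provable: JET `Rank1ResidualJetTildeClassLevelLink`, x11b3 `torsionH1OfDvd_kolyvaginClass…`);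
  - `stub_localTrivialAtConductor` (T1) — landed CONDITIONALLY on Q2 `KolyvaginRelationAtTwo`
    (p612374), itself landed modulo Gross 1991 Prop. 3.7 (2) (p614530).
* glue `KolyvaginCorankLowerBoundAtTwoTheta_of` (depth split, `θ := 2`, `k := c₀ + 2c₁ + 1`).

HONEST FRAMING: S1 is beyond print at `2` (its inside: joint Čebotarev — landed by krr2-p2 —, the
auxiliary class from the signed Poitou–Tate count at `2`, the reciprocity law, Q2 at the two primes,
the local pairings at Kolyvagin primes); nothing here proves V2♭θ or BSD while `sorry`s remain.
-/

set_option autoImplicit false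
-- the Theorems namespace of this sub repeats the summit name by design (D-0017 nested layout)
set_option linter.dupNamespace false

noncomputable section

open scoped Classical

open WeierstrassCurve Literature.NumberTheory.EllipticCurves
  Literature.NumberTheory.EllipticCurves.ModularForms NumberField IsDedekindDomain
open Summit.BirchSwinnertonDyer.BirchSwinnertonDyer.Theses.KolyvaginRankRigidityAtTwo

namespace Summit.BirchSwinnertonDyer.BirchSwinnertonDyer.Theorems.KolyvaginLowerBoundAtTwo

/-! ## The registered stubs -/

/-- **S1 — the PRIME SWAP at `2`** ([1, Prop. 8] = McCallum 1991 Prop. 5.2 (proof) = W. Zhang 2014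
Lemma 8.4 (step), at level `2^M`, lossless form under the relative-order condition `M + c₀ ≤ 2j`):
from a window `∏ T` on Kolyvagin primes of index `≥ M + 1` whose class is large
(`2^j c_M ∉ ker loc` at fresh Kolyvagin primes of index `≥ I` outside any finite set) and `a ∈ T`, a
fresh Kolyvagin prime `ℓ` of index `≥ I` testing the class, and a datum on `insert ℓ (T ∖ a)` whose
class is again large with the SAME `j`. Inside: joint Čebotarev for two classes, the auxiliary class
from the signed Poitou–Tate count, the reciprocity law, McCallum 4.4 at `ℓ` and at `a` (= Q2), the
local pairings at Kolyvagin primes at `2`. THE research kernel; not in print at `2`.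
[cite: Kolyvagin1991MathAnn, §2 Thm. 2.2 (ref. [1] Prop. 8), p. 257] [cite: McCallumLMS1991, §5 Prop. 5.2]
[cite: WZhang2014, Lemma 8.4] -/
theorem stub_primeSwapAtTwo :
    ∀ (W : WeierstrassCurve ℚ) [W.IsElliptic] [W.IsGloballyMinimal], ¬ W.HasCM →
      (Rank1Residual.GoodOrd W 2 ∨ Rank1Residual.Mult W 2) →
      (∀ m : ℕ, W.HasSurjectiveModNGaloisRep (2 ^ m : ℕ)) →
      ∀ (K : Type) [Field K] [NumberField K], IsImaginaryQuadratic K → NumberField.discr K ≠ -3 →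
      NumberField.discr K ≠ -4 → ¬ ((2 : ℤ) ∣ NumberField.discr K) → ∀ [NeZero (W.conductorNorm ℤ)],
      SatisfiesHeegnerHypothesis (W.conductorNorm ℤ) K →
      ∃ c₀ : ℕ, ∀ (Dt : ModularParametrizationData W (W.conductorNorm ℤ)) (β : ℤ) (ι : K →+* ℂ),
        ∀ (M I : ℕ) (T : Finset ℕ) (a : ℕ)
          (dat : KolyvaginHeegnerData Dt β ι (∏ p ∈ T, p)) (j : ℕ) (X : Finset ℕ),
          1 ≤ M → M + 1 ≤ I →
          (∀ p ∈ T, Zhang2014.IsKolyvaginPrime (W.conductorNorm ℤ) W K 2 p ∧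
            M + 1 ≤ Zhang2014.kolyvaginIndex W 2 p) →
          a ∈ T → M + c₀ ≤ 2 * j →
          (∀ X' : Finset ℕ, ∃ q : ℕ, q ∉ X' ∧ Zhang2014.IsKolyvaginPrime (W.conductorNorm ℤ) W K 2 q ∧
            I ≤ Zhang2014.kolyvaginIndex W 2 q ∧
            ∃ v : HeightOneSpectrum (𝓞 K), ((q : ℕ) : 𝓞 K) ∈ v.asIdeal ∧
              ((2 ^ j : ℕ) : ℤ) • dat.kolyvaginClass Nat.prime_two M ∉
                (W.baseChange K).torsionLocalKer (v.adicCompletion K) ((2 ^ M : ℕ) : ℤ)) →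
          ∃ ℓ : ℕ, ℓ ∉ X ∧ ℓ ∉ T ∧ Zhang2014.IsKolyvaginPrime (W.conductorNorm ℤ) W K 2 ℓ ∧
            I ≤ Zhang2014.kolyvaginIndex W 2 ℓ ∧
            (∃ v : HeightOneSpectrum (𝓞 K), ((ℓ : ℕ) : 𝓞 K) ∈ v.asIdeal ∧
              ((2 ^ j : ℕ) : ℤ) • dat.kolyvaginClass Nat.prime_two M ∉
                (W.baseChange K).torsionLocalKer (v.adicCompletion K) ((2 ^ M : ℕ) : ℤ)) ∧
            ∃ dat' : KolyvaginHeegnerData Dt β ι (∏ p ∈ insert ℓ (T.erase a), p),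
              (∀ X' : Finset ℕ, ∃ q : ℕ, q ∉ X' ∧ Zhang2014.IsKolyvaginPrime (W.conductorNorm ℤ) W K 2 q ∧
                I ≤ Zhang2014.kolyvaginIndex W 2 q ∧
                ∃ v : HeightOneSpectrum (𝓞 K), ((q : ℕ) : 𝓞 K) ∈ v.asIdeal ∧
                  ((2 ^ j : ℕ) : ℤ) • dat'.kolyvaginClass Nat.prime_two M ∉
                    (W.baseChange K).torsionLocalKer (v.adicCompletion K) ((2 ^ M : ℕ) : ℤ)) := by
  sorry

/-! ### S2 `stub_chebotarevOneClassIndexAtTwo` — LANDED (krr2-p2, `Theorems/…MarginChebotarevOneClassIndexAtTwo.lean`, c₁ = 2; imported). -/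

-- S3 `stub_localOrderLevelUpAtTwo` LANDED (krr2-p2, `…MarginLocalOrderLevelUpAtTwo.lean`): imported, decl removed here.

/-! ### S4 `stub_globalOrderLevelUpAtTwo` — LANDED (lead g7, p621416; imported). -/

/-- **T1 — local triviality at the primes of the conductor** (margin one; McCallum 4.4 / Gross 6.2
(2) at `2`): LANDED conditionally on Q2 `KolyvaginRelationAtTwo`
(`stub_localTrivialAtConductor_of_kolyvaginRelationAtTwo`, p612374; Q2 landed modulo Gross 1991
Prop. 3.7 (2), p614530). [cite: McCallumLMS1991, §4 Prop. 4.4, Cor. 4.5] [cite: GrossLMS1991, §6 Prop. 6.2 (2)] -/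
theorem stub_localTrivialAtConductor :
    ∀ (W : WeierstrassCurve ℚ) [W.IsElliptic] [W.IsGloballyMinimal], ¬ W.HasCM →
      (Rank1Residual.GoodOrd W 2 ∨ Rank1Residual.Mult W 2) →
      (∀ m : ℕ, W.HasSurjectiveModNGaloisRep (2 ^ m : ℕ)) →
      ∀ (K : Type) [Field K] [NumberField K], IsImaginaryQuadratic K → NumberField.discr K ≠ -3 →
      NumberField.discr K ≠ -4 → ¬ ((2 : ℤ) ∣ NumberField.discr K) → ∀ [NeZero (W.conductorNorm ℤ)],
      SatisfiesHeegnerHypothesis (W.conductorNorm ℤ) K →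
      ∀ (Dt : ModularParametrizationData W (W.conductorNorm ℤ)) (β : ℤ) (ι : K →+* ℂ)
        (n : ℕ) (d : KolyvaginHeegnerData Dt β ι n) (M ℓ : ℕ),
        KolyvaginDescent.KolSupp (Zhang2014.IsKolyvaginPrime (W.conductorNorm ℤ) W K 2) n →
        1 ≤ M → ((M + 1 : ℕ) : ℕ∞) ≤ Zhang2014.levelIndex W 2 n → ℓ ∈ n.primeFactors →
        (∀ d₀ : KolyvaginHeegnerData Dt β ι (n / ℓ), d₀.kolyvaginClass Nat.prime_two M = 0) →
        ∀ v : HeightOneSpectrum (𝓞 K), ((ℓ : ℕ) : 𝓞 K) ∈ v.asIdeal →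
          d.kolyvaginClass Nat.prime_two M ∈
            (W.baseChange K).torsionLocalKer (v.adicCompletion K) ((2 ^ M : ℕ) : ℤ) := by
  sorry

/-! ### T2 `stub_selmerAwayFromConductor` (p612348, krr2-p2) and T3 `stub_conjSign` (p611883) are
LANDED theorems (imported). -/

/-! ## Depth zero (PROVED; no minimality needed) -/

/-- **Depth `ν = 0`**: a non-zero class `c_M(1) ≠ 0` forces `y_K` to have infinite order, so
`1 ≤ rank E(K) = rank E(ℚ) + rank E^{(d_K)}(ℚ) ≤ c + c'` (Mordell–Weil road; the landed
`stub_depthZero` p606050 with its idle minimality binder removed).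
[cite: GrossLMS1991, §4 (4.1) and Prop. 4.7 (1)] [cite: Greenberg1999LNM, §1 pp. 53–57] -/
theorem depthZeroMargin (W : WeierstrassCurve ℚ) [W.IsElliptic] [W.IsGloballyMinimal]
    (K : Type) [Field K] [NumberField K] (hK : IsImaginaryQuadratic K) [NeZero (W.conductorNorm ℤ)]
    (hHN : SatisfiesHeegnerHypothesis (W.conductorNorm ℤ) K)
    (Dt : ModularParametrizationData W (W.conductorNorm ℤ)) (β : ℤ) (ι : K →+* ℂ) (n : ℕ)
    (d : KolyvaginHeegnerData Dt β ι n) (M : ℕ)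
    (hn : KolyvaginDescent.KolSupp (Zhang2014.IsKolyvaginPrime (W.conductorNorm ℤ) W K 2) n)
    (hne : d.kolyvaginClass Nat.prime_two M ≠ 0) (hν : n.primeFactors.card = 0) :
    n.primeFactors.card + 1 ≤ W.selmerCorank 2 ∨
      n.primeFactors.card + 1 ≤ (W.quadraticTwist (NumberField.discr K : ℚ)).selmerCorank 2 := by
  -- `n` is square-free with no prime factor: `n = 1`
  have hn1 : n = 1 := by
    rw [Finset.card_eq_zero, Nat.primeFactors_eq_empty] at hν
    rcases hν with h0 | h1
    · exact absurd (h0 ▸ hn.1) not_squarefree_zero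
    · exact h1
  subst hn1
  rw [hν]
  haveI : Fact (Nat.Prime 2) := ⟨Nat.prime_two⟩
  -- `c_M(1) ≠ 0` forces `P(1)` to have infinite order (Gross 1991, Prop. 4.7 (1))
  have hnt : ¬ IsOfFinAddOrder d.derivedPoint := fun hfin ↦
    hne (heegnerSystem_kolyvaginClass_eq_zero_of_isOfFinAddOrder d Nat.prime_two M hfin)
  -- `P(1) = Tr_{K[1]/K} y(1)` descends to `P₀ ∈ E(K)` (reciprocity at conductor `1` is a theorem)
  obtain ⟨P₀, -, hP₀⟩ := heegnerSystem_exists_isHeegnerPoint_map_eq_derivedPoint_one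
    (heegnerPointOfConductor_one_galoisConj_holds _ W K) hK hHN d
  have hnt₀ : ¬ IsOfFinAddOrder P₀ := fun h ↦ hnt (hP₀ ▸
    (WeierstrassCurve.Affine.Point.map (W' := W)
      (algebraMap K (ringClassField K ι 1)).toRatAlgHom).isOfFinAddOrder h)
  -- Mordell–Weil: `1 ≤ rank E(K) = rank E(ℚ) + rank E^{(d_K)}(ℚ)`
  haveI : (W.baseChange K).IsElliptic := by rw [baseChange]; infer_instance
  have hge : 1 ≤ (W.baseChange K).mordellWeilRank :=
    one_le_mordellWeilRank_of_not_isOfFinAddOrder _ (W.baseChange K).module_finite_point_holds hnt₀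
  have hrk := mordellWeilRank_baseChange_quadratic_holds W K hK.1
  -- `corank Sel_{2^∞} = rank + corank Ш[2^∞]` for `E` and for `E^{(d_K)}`
  have hd : (NumberField.discr K : ℚ) ≠ 0 := by exact_mod_cast NumberField.discr_ne_zero K
  haveI := W.isElliptic_quadraticTwist hd
  have hQ := W.selmerCorank_eq_mordellWeilRank_add_holds 2
  have hT := (W.quadraticTwist (NumberField.discr K : ℚ)).selmerCorank_eq_mordellWeilRank_add_holds 2
  omega

/-! ## Positive depth (PROVED from S0–S4, T1 and the landed T2, T3, swap induction, triangular systems) -/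

/-- **LOWER bound at minimal depth `ν ≥ 1`, relative margin `(2, c₀ + 2c₁ + 1)`**: Kolyvagin's Thm. 2.2
at `2` assembled — windows at every level from the prime swap (`windowsTheta_of_swap`, p619681, fed by
S1–S4), then the triangular system of Selmer eigen-classes `η_i = 2^t c_M(n_i)`
(T1 at the window primes with the supplied vanishing, T2 elsewhere, T3 for the sign) read by
`lowerBound_of_levelTriangularSystems` (p610758). [cite: Kolyvagin1991MathAnn, §2 Thm. 2.2–2.3]
[cite: WZhang2014, Lemma 8.4] -/
theorem posDepthTheta (W : WeierstrassCurve ℚ) [W.IsElliptic] [W.IsGloballyMinimal] (hCM : ¬ W.HasCM)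
    (hred : Rank1Residual.GoodOrd W 2 ∨ Rank1Residual.Mult W 2)
    (hsur : ∀ m : ℕ, W.HasSurjectiveModNGaloisRep (2 ^ m : ℕ))
    (K : Type) [Field K] [NumberField K] (hK : IsImaginaryQuadratic K) (hne3 : NumberField.discr K ≠ -3)
    (hne4 : NumberField.discr K ≠ -4) (h2d : ¬ ((2 : ℤ) ∣ NumberField.discr K))
    [NeZero (W.conductorNorm ℤ)] (hHN : SatisfiesHeegnerHypothesis (W.conductorNorm ℤ) K)
    (Dt : ModularParametrizationData W (W.conductorNorm ℤ)) (β : ℤ) (ι : K →+* ℂ) (c₀ c₁ : ℕ)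
    (hswap :
        ∀ (M I : ℕ) (T : Finset ℕ) (a : ℕ)
          (dat : KolyvaginHeegnerData Dt β ι (∏ p ∈ T, p)) (j : ℕ) (X : Finset ℕ),
          1 ≤ M → M + 1 ≤ I →
          (∀ p ∈ T, Zhang2014.IsKolyvaginPrime (W.conductorNorm ℤ) W K 2 p ∧
            M + 1 ≤ Zhang2014.kolyvaginIndex W 2 p) →
          a ∈ T → M + c₀ ≤ 2 * j →
          (∀ X' : Finset ℕ, ∃ q : ℕ, q ∉ X' ∧ Zhang2014.IsKolyvaginPrime (W.conductorNorm ℤ) W K 2 q ∧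
            I ≤ Zhang2014.kolyvaginIndex W 2 q ∧
            ∃ v : HeightOneSpectrum (𝓞 K), ((q : ℕ) : 𝓞 K) ∈ v.asIdeal ∧
              ((2 ^ j : ℕ) : ℤ) • dat.kolyvaginClass Nat.prime_two M ∉
                (W.baseChange K).torsionLocalKer (v.adicCompletion K) ((2 ^ M : ℕ) : ℤ)) →
          ∃ ℓ : ℕ, ℓ ∉ X ∧ ℓ ∉ T ∧ Zhang2014.IsKolyvaginPrime (W.conductorNorm ℤ) W K 2 ℓ ∧
            I ≤ Zhang2014.kolyvaginIndex W 2 ℓ ∧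
            (∃ v : HeightOneSpectrum (𝓞 K), ((ℓ : ℕ) : 𝓞 K) ∈ v.asIdeal ∧
              ((2 ^ j : ℕ) : ℤ) • dat.kolyvaginClass Nat.prime_two M ∉
                (W.baseChange K).torsionLocalKer (v.adicCompletion K) ((2 ^ M : ℕ) : ℤ)) ∧
            ∃ dat' : KolyvaginHeegnerData Dt β ι (∏ p ∈ insert ℓ (T.erase a), p),
              (∀ X' : Finset ℕ, ∃ q : ℕ, q ∉ X' ∧ Zhang2014.IsKolyvaginPrime (W.conductorNorm ℤ) W K 2 q ∧
                I ≤ Zhang2014.kolyvaginIndex W 2 q ∧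
                ∃ v : HeightOneSpectrum (𝓞 K), ((q : ℕ) : 𝓞 K) ∈ v.asIdeal ∧
                  ((2 ^ j : ℕ) : ℤ) • dat'.kolyvaginClass Nat.prime_two M ∉
                    (W.baseChange K).torsionLocalKer (v.adicCompletion K) ((2 ^ M : ℕ) : ℤ)))
    (hcheb :
        ∀ (n : ℕ) (dat : KolyvaginHeegnerData Dt β ι n) (M m I : ℕ),
          KolyvaginDescent.KolSupp (Zhang2014.IsKolyvaginPrime (W.conductorNorm ℤ) W K 2) n →
          1 ≤ M → (M : ℕ∞) ≤ Zhang2014.levelIndex W 2 n → M ≤ I → c₁ ≤ m →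
          ((2 ^ m : ℕ) : ℤ) • dat.kolyvaginClass Nat.prime_two M ≠ 0 →
          (∀ X' : Finset ℕ, ∃ q : ℕ, q ∉ X' ∧ Zhang2014.IsKolyvaginPrime (W.conductorNorm ℤ) W K 2 q ∧
            I ≤ Zhang2014.kolyvaginIndex W 2 q ∧
            ∃ v : HeightOneSpectrum (𝓞 K), ((q : ℕ) : 𝓞 K) ∈ v.asIdeal ∧
              ((2 ^ (m - c₁) : ℕ) : ℤ) • dat.kolyvaginClass Nat.prime_two M ∉
                (W.baseChange K).torsionLocalKer (v.adicCompletion K) ((2 ^ M : ℕ) : ℤ)))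
    (hlocUp :
        ∀ (n : ℕ) (dat : KolyvaginHeegnerData Dt β ι n) (M M' j q : ℕ)
          (v : HeightOneSpectrum (𝓞 K)),
          KolyvaginDescent.KolSupp (Zhang2014.IsKolyvaginPrime (W.conductorNorm ℤ) W K 2) n →
          1 ≤ M → M ≤ M' → (M' : ℕ∞) ≤ Zhang2014.levelIndex W 2 n →
          Zhang2014.IsKolyvaginPrime (W.conductorNorm ℤ) W K 2 q → M' ≤ Zhang2014.kolyvaginIndex W 2 q →
          ¬ q ∣ n → ((q : ℕ) : 𝓞 K) ∈ v.asIdeal →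
          ((2 ^ j : ℕ) : ℤ) • dat.kolyvaginClass Nat.prime_two M ∉
            (W.baseChange K).torsionLocalKer (v.adicCompletion K) ((2 ^ M : ℕ) : ℤ) →
          ((2 ^ (j + (M' - M)) : ℕ) : ℤ) • dat.kolyvaginClass Nat.prime_two M' ∉
            (W.baseChange K).torsionLocalKer (v.adicCompletion K) ((2 ^ M' : ℕ) : ℤ))
    (hglobUp :
        ∀ (n : ℕ) (dat : KolyvaginHeegnerData Dt β ι n) (M M' j : ℕ),
          KolyvaginDescent.KolSupp (Zhang2014.IsKolyvaginPrime (W.conductorNorm ℤ) W K 2) n →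
          1 ≤ M → M ≤ M' → (M' : ℕ∞) ≤ Zhang2014.levelIndex W 2 n →
          ((2 ^ j : ℕ) : ℤ) • dat.kolyvaginClass Nat.prime_two M ≠ 0 →
          ((2 ^ (j + (M' - M)) : ℕ) : ℤ) • dat.kolyvaginClass Nat.prime_two M' ≠ 0) :
    ∀ (n : ℕ) (d : KolyvaginHeegnerData Dt β ι n) (M : ℕ),
      KolyvaginDescent.KolSupp (Zhang2014.IsKolyvaginPrime (W.conductorNorm ℤ) W K 2) n →
      1 ≤ M → ((2 * M + (c₀ + 2 * c₁ + 1) : ℕ) : ℕ∞) ≤ Zhang2014.levelIndex W 2 n →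
      d.kolyvaginClass Nat.prime_two M ≠ 0 →
      (∀ (n' : ℕ) (d' : KolyvaginHeegnerData Dt β ι n') (M' : ℕ),
        KolyvaginDescent.KolSupp (Zhang2014.IsKolyvaginPrime (W.conductorNorm ℤ) W K 2) n' →
        1 ≤ M' → ((2 * M' + (c₀ + 2 * c₁ + 1) : ℕ) : ℕ∞) ≤ Zhang2014.levelIndex W 2 n' →
        d'.kolyvaginClass Nat.prime_two M' ≠ 0 → n.primeFactors.card ≤ n'.primeFactors.card) →
      0 < n.primeFactors.card →
      (n.primeFactors.card + 1 ≤ W.selmerCorank 2 ∨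
        n.primeFactors.card + 1 ≤ (W.quadraticTwist (NumberField.discr K : ℚ)).selmerCorank 2) := by
  intro n d M hn hM1 hMle hne hmin hpos
  set N := W.conductorNorm ℤ with hNdef
  set k : ℕ := c₀ + 2 * c₁ + 1 with hk
  set ν := n.primeFactors.card with hνdef
  haveI : Fact (Nat.Prime 2) := ⟨Nat.prime_two⟩
  -- θ-minimality (θ = 2, margin `k`), contrapositive form
  have hmin' : ∀ (n' : ℕ) (d' : KolyvaginHeegnerData Dt β ι n') (M' : ℕ),
      KolyvaginDescent.KolSupp (Zhang2014.IsKolyvaginPrime N W K 2) n' →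
      1 ≤ M' → ((2 * M' + k : ℕ) : ℕ∞) ≤ Zhang2014.levelIndex W 2 n' → n'.primeFactors.card < ν →
      d'.kolyvaginClass Nat.prime_two M' = 0 := by
    intro n' d' M' hn' hM1' hMle' hlt
    by_contra hne'
    exact absurd (hmin n' d' M' hn' hM1' hMle' hne') (not_le.mpr hlt)
  -- windows at every level (landed swap induction, θ = 2)
  have hWin := windowsTheta_of_swap W K Dt β ι 2 k c₀ c₁ le_rfl (by omega) hswap hcheb hlocUp hglobUp
    ν hpos ⟨n, d, M, hn, rfl, hM1, hMle, hne⟩ hmin'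
  -- the quadratic field: `K = ℚ(θ)`, `θ² = d_K`, `σ₀` its non-trivial automorphism
  obtain ⟨θ, hθ, hc⟩ := exists_sq_eq_discr_not_mem_range K hK.1
  set σ₀ := sigmaQ K hK.1 hθ hc with hσ₀
  have hσ₀1 : σ₀ ≠ 1 := sigmaQ_ne_one K hK.1 hθ hc
  -- the other stubs / landed pieces on this frame
  have hT1 := stub_localTrivialAtConductor W hCM hred hsur K hK hne3 hne4 h2d hHN Dt β ι
  obtain ⟨t, hT2⟩ :=
    KolyvaginRankRigidity.stub_selmerAwayFromConductor W hCM hred hsur K hK hne3 hne4 h2d hHN Dt β ι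
  obtain ⟨f, dd, hνf, hT5⟩ := hWin
  obtain ⟨ε, hε1, hT3⟩ := stub_conjSign W hCM hred hsur K hK hne3 hne4 h2d hHN Dt β ι σ₀ hσ₀1 f
  -- `E(K)[2] = 0` (landed support `NoTwoTorsionOverK`)
  have htor : AddSubgroup.torsionBy (W.baseChange K).toAffine.Point (2 : ℤ) = ⊥ :=
    KolyvaginRankRigidity.noTwoTorsionOverK_proof W hsur K hK
  -- it suffices to bound by `f + 1 ≥ ν + 1`
  suffices h : f + 1 ≤ W.selmerCorank 2 ∨
      f + 1 ≤ (W.quadraticTwist (NumberField.discr K : ℚ)).selmerCorank 2 by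
    rcases h with h | h
    · exact Or.inl (le_trans (by omega) h)
    · exact Or.inr (le_trans (by omega) h)
  -- the level-`2^M'` triangular systems at depth `f`
  refine lowerBound_of_levelTriangularSystems W K hK.1 hθ hc htor f (dd + t) ε hε1 fun M' ↦ ?_
  rcases Nat.eq_zero_or_pos M' with hM'0 | hM'pos
  · subst hM'0
    obtain ⟨-, -, v₁, -, -⟩ := hT5 1 le_rfl
    refine ⟨fun _ ↦ 0, v₁, fun _ ↦ zero_mem _, fun _ ↦ by rw [map_zero, zsmul_zero],
      fun _ _ _ ↦ zero_mem _, fun _ e he ↦ absurd he (by omega)⟩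
  obtain ⟨S, q, v, dat, hcard, hprimes, hinc, hqv, hvan0, hdiag⟩ := hT5 M' hM'pos
  -- facts on the window conductors
  have hSprime : ∀ i, ∀ p ∈ S i, p.Prime := fun i p hp ↦ (hprimes i p hp).1.1
  have hpf : ∀ i, (∏ p ∈ S i, p).primeFactors = S i := fun i ↦ Nat.primeFactors_prod (hSprime i)
  have hsq : ∀ i, Squarefree (∏ p ∈ S i, p) := fun i ↦ by
    refine Finset.squarefree_prod_of_pairwise_isCoprime (fun a ha b hb hab ↦ ?_)
      fun p hp ↦ (hSprime i p hp).squarefree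
    simp only [← Nat.coprime_iff_isRelPrime]
    exact (Nat.coprime_primes (hSprime i a ha) (hSprime i b hb)).mpr hab
  have hsupp : ∀ i, KolyvaginDescent.KolSupp (Zhang2014.IsKolyvaginPrime N W K 2) (∏ p ∈ S i, p) :=
    fun i ↦ ⟨hsq i, fun p hp ↦ (hprimes i p (by rwa [hpf i] at hp)).1⟩
  have hlev1 : ∀ i, ((M' + 1 : ℕ) : ℕ∞) ≤ Zhang2014.levelIndex W 2 (∏ p ∈ S i, p) := fun i ↦ by
    rw [Zhang2014.natCast_le_levelIndex_iff]
    intro p hp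
    rw [hpf i] at hp
    exact (hprimes i p hp).2
  have hlev : ∀ i, ((M' : ℕ) : ℕ∞) ≤ Zhang2014.levelIndex W 2 (∏ p ∈ S i, p) := fun i ↦
    le_trans (by exact_mod_cast Nat.le_succ M') (hlev1 i)
  -- T1 at every prime `ℓ ∣ n_i` (vanishing of the classes of conductor `n_i/ℓ` supplied by the windows)
  have hloc : ∀ i, ∀ ℓ ∈ S i, ∀ w : HeightOneSpectrum (𝓞 K), ((ℓ : ℕ) : 𝓞 K) ∈ w.asIdeal →
      (dat i).kolyvaginClass Nat.prime_two M' ∈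
        (W.baseChange K).torsionLocalKer (w.adicCompletion K) ((2 ^ M' : ℕ) : ℤ) :=
    fun i ℓ hℓ w hw ↦ hT1 _ (dat i) M' ℓ (hsupp i) hM'pos (hlev1 i) (by rw [hpf i]; exact hℓ)
      (hvan0 i ℓ hℓ) w hw
  -- the classes
  refine ⟨fun i ↦ ((2 ^ t : ℕ) : ℤ) • (dat i).kolyvaginClass Nat.prime_two M', v, ?_, ?_, ?_, ?_⟩
  · -- Selmer
    intro i
    rw [mem_selmerGroup_iff]
    refine ⟨fun w ↦ ?_, fun w ↦ ?_⟩
    · by_cases hw : (((∏ p ∈ S i, p : ℕ) : ℕ) : 𝓞 K) ∈ w.asIdeal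
      · rw [Nat.cast_prod] at hw
        obtain ⟨ℓ, hℓ, hℓw⟩ := Ideal.IsPrime.prod_mem_iff.mp hw
        exact AddSubgroup.zsmul_mem _
          ((W.baseChange K).torsionLocalKer_le_selmerLocalKer _ _ (hloc i ℓ hℓ w hℓw)) _
      · exact hT2 _ (dat i) M' (hsupp i) hM'pos (hlev i) w hw
    · haveI : IsAlgClosed w.Completion := isAlgClosed_of_ringEquiv
        (InfinitePlace.Completion.ringEquivComplexOfIsComplex (hK.2.isComplex w)).symm
      rw [WeierstrassCurve.selmerLocalKer_eq_top_of_isAlgClosed]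
      trivial
  · -- eigen
    intro i
    rw [map_zsmul, hT3 _ (dat i) M' (hsupp i) (by rw [hpf i, hcard i]) hM'pos (hlev i),
      smul_comm]
  · -- triangular
    intro i j hij
    exact AddSubgroup.zsmul_mem _ (hloc i (q j) (hinc i j hij) (v j) (hqv j)) _
  · -- diagonal
    intro i e he hmem
    refine hdiag i (e + t) (by omega) ?_
    rw [pow_add, Nat.cast_mul, ← smul_smul]
    exact hmem

/-! ## Glue -/

/-- **V2♭θ from the depth split**, with `θ := 2`, `k := c₀ + 2c₁ + 1` (`c₀`, `c₁` the constants
of S1, S2): no hypothesis beyond the item's own statement, so closing the registered stubs closes the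
crux by name. [cite: Kolyvagin1991MathAnn, §2 Thm. 2.2 and p. 257] -/
theorem KolyvaginCorankLowerBoundAtTwoTheta_of : KolyvaginCorankLowerBoundAtTwoTheta := by
  intro W _ _ hCM hred hsur K _ _ hK hne3 hne4 h2d _ hHN
  obtain ⟨c₀, hS1⟩ := stub_primeSwapAtTwo W hCM hred hsur K hK hne3 hne4 h2d hHN
  obtain ⟨c₁, hS2⟩ := stub_chebotarevOneClassIndexAtTwo W hCM hred hsur K hK hne3 hne4 h2d hHN
  refine ⟨2, c₀ + 2 * c₁ + 1, fun Dt β ι n d M hn hM1 hMle hne hmin ↦ ?_⟩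
  rcases Nat.eq_zero_or_pos n.primeFactors.card with h0 | hpos
  · exact depthZeroMargin W K hK hHN Dt β ι n d M hn hne h0
  · exact posDepthTheta W hCM hred hsur K hK hne3 hne4 h2d hHN Dt β ι c₀ c₁ (hS1 Dt β ι) (hS2 Dt β ι)
      (stub_localOrderLevelUpAtTwo W hCM hred hsur K hK hne3 hne4 h2d hHN Dt β ι)
      (stub_globalOrderLevelUpAtTwo W hCM hred hsur K hK hne3 hne4 h2d hHN Dt β ι)
      n d M hn hM1 hMle hne hmin hpos

end Summit.BirchSwinnertonDyer.BirchSwinnertonDyer.Theorems.KolyvaginLowerBoundAtTwo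

end
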